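import Literature.Analysis.FluidPDE.SereginZajaczkowski2007L42
import Literature.Analysis.FluidPDE.AxisymShellSobolev
import HarnessLib

/-!
# Seregin–Zajaczkowski 2007, Lemma 4.2: kinematics of a locally axially symmetric field on a
# shell, read in the meridian half-plane

Analysis/FluidPDE support file (everything proved; no definitions, no named facts) for the
discharge of the named fact `SereginZajaczkowski2007.PoloidalLqOfVorticityL2` (the kinematic
half of the proof of G. Seregin, W. Zajaczkowski, SIAM J. Math. Anal. 39 (2007) 669–685 =
arXiv:math/0702720, Lemma 4.2: "(4.3) `V_{ϱ,ϱ} + V_{3,3} = -V_ϱ/ϱ`, (4.4) `V_{ϱ,3} - V_{3,ϱ} = χ`"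
for the cylindrical components of an axially symmetric divergence-free field, `χ = ω_φ`, and the
passage between `∫_{𝒞} … dx` and `∫∫ … dϱ dx₃`, arXiv pp. 5–6).

The fact `PoloidalLqOfVorticityL2` concerns ONE field `u : ℝ³ → ℝ³` which is smooth and axially
symmetric only at the points of an open shell `𝒞 = 𝒞(R₁, R₂; a)` (not on all of `ℝ³`), so the
tree's global statements (`IsAxisymmetric.fderiv_rotGen`, `IsAxisymmetric.curl`, …) do not apply
verbatim; this file supplies their local versions and reads them at the meridian points
`(ϱ, 0, z)`, `ϱ > 0`, where the cylindrical frame is the standard frame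
(`e_ϱ = e₀`, `e_φ = e₁`, `e₃ = e₂`):

* local equivariance on a rotation-invariant open set `U`: `Du(x)[J x] = J u(x)`
  (`fderiv_rotGen_of_mem`), `Du(R_θ x) = R_θ Du(x) R_{-θ}` (`fderiv_rotZ_of_mem`),
  `curl u (R_θ x) = R_θ curl u (x)` and `ω_φ (R_θ x) = ω_φ (x)` (`curl_rotZ_of_mem`,
  `angularVorticity_rotZ_of_mem`);
* at a meridian point `x = (ϱ, 0, z)`, `ϱ > 0`: `J x = ϱ e₁`, `e_φ = e₁`, `e_ϱ = e₀`, hence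
  `∂₁u₁ = u₀/ϱ` (`fderiv_single_one_apply_one`), (4.3) in the form
  `div u = ∂₀u₀ + u₀/ϱ + ∂₂u₂` (`divergence_meridianPoint`) and (4.4) in the form
  `ω_φ = ∂₂u₀ - ∂₀u₂` (`angularVorticity_meridianPoint`);
* the cylindrical components of `u` at a point `x` of a shell are the Cartesian components at the
  meridian point `m = (ϱ(x), 0, x₃)`: `u_ϱ(x) = u₀(m)`, `u₃(x) = u₂(m)`, `|u(x)| = |u(m)|`,
  `ω_φ(x) = ω_φ(m)` (`radialVelocity_eq_meridianPoint`, …), so that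
  `|u^a(x)|² = u₀(m)² + u₂(m)²` (`poloidalSpeed_sq_eq_meridianPoint`);
* calculus of meridian profiles `q ↦ u(meridianPoint q) i` and of their products with a planar
  cut-off (`contDiffAt_apply_comp_meridianPoint`, `fderiv_apply_comp_meridianPoint`,
  `contDiff_mul_of_tsupport_subset`, `fderiv_mul_apply_of_mem`);
* two measure-theoretic odds and ends of the passage `dx ↔ dϱ dx₃`: the operator norm of a linear
  form on `ℝ × ℝ` against its two partial values (`norm_le_abs_add_abs`), and the even reflection
  `∫ Y(|ϱ|, z) = 2 ∫ Y` for `Y` vanishing on `ϱ ≤ 0` (`integral_comp_abs_fst`).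

All statements are folklore calculus.

## References

* G. Seregin, W. Zajaczkowski, SIAM J. Math. Anal. 39 (2007) 669–685, arXiv:math/0702720, proof
  of Lemma 4.2, (4.3)–(4.4) and the displays on p. 6. [`SereginZajaczkowski2007`]
-/

noncomputable section

open MeasureTheory Set Function Filter Topology TopologicalSpace Metric WithLp
open scoped NNReal ENNReal ContDiff InnerProductSpace RealInnerProductSpace

namespace Literature.Analysis.FluidPDE

namespace SereginZajaczkowski2007

open SereginSverak2009

/-- Local notation for physical space `ℝ³ = EuclideanSpace ℝ (Fin 3)`. -/
local notation "ℝ³" => EuclideanSpace ℝ (Fin 3)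

/-! ### Local axial symmetry on a rotation-invariant open set -/

section LocalSymmetry

variable {U : Set ℝ³} {u : ℝ³ → ℝ³}

/-- **Infinitesimal axisymmetry, local form**: if `u (R_θ x) = R_θ (u x)` for all `θ` at the
points of a rotation-invariant set `U` and `u` is differentiable at `x ∈ U`, then
`Du(x)[J x] = J (u x)` (differentiate in `θ` at `θ = 0`). [folklore] -/
theorem fderiv_rotGen_of_mem
    (hu : ∀ θ : ℝ, ∀ x ∈ U, u (rotZ θ x) = rotZ θ (u x)) {x : ℝ³} (hx : x ∈ U)
    (hd : DifferentiableAt ℝ u x) : fderiv ℝ u x (rotGen x) = rotGen (u x) := by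
  have h1 : HasDerivAt (fun θ => u (rotZ θ x)) (fderiv ℝ u x (rotGen x)) 0 := by
    have hu' : HasFDerivAt u (fderiv ℝ u x) (rotZ 0 x) := by
      rw [rotZ_zero]; exact hd.hasFDerivAt
    exact hu'.comp_hasDerivAt (0 : ℝ) (hasDerivAt_rotZ_zero x)
  have heq : (fun θ => u (rotZ θ x)) = fun θ => rotZ θ (u x) := funext fun θ => hu θ x hx
  rw [heq] at h1
  exact h1.unique (hasDerivAt_rotZ_zero (u x))

/-- **Equivariance of the Jacobian, local form**: on a rotation-invariant open set `U` on which
`u` is differentiable and `u (R_θ y) = R_θ (u y)`, `Du(R_θ x) = R_θ ∘ Du(x) ∘ R_{-θ}` for `x ∈ U`.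
[folklore] -/
theorem fderiv_rotZ_of_mem (hU : IsOpen U) (hUrot : ∀ θ : ℝ, ∀ x ∈ U, rotZ θ x ∈ U)
    (hu : ∀ θ : ℝ, ∀ x ∈ U, u (rotZ θ x) = rotZ θ (u x))
    (hd : ∀ x ∈ U, DifferentiableAt ℝ u x) (θ : ℝ) {x : ℝ³} (hx : x ∈ U) :
    fderiv ℝ u (rotZ θ x) = (rotZL θ).comp ((fderiv ℝ u x).comp (rotZL (-θ))) := by
  have hcomp : (fun y => u (rotZL θ y)) =ᶠ[𝓝 x] fun y => rotZL θ (u y) := by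
    filter_upwards [hU.mem_nhds hx] with y hy
    exact hu θ y hy
  have hl : HasFDerivAt (fun y => u (rotZL θ y)) ((fderiv ℝ u (rotZ θ x)).comp (rotZL θ)) x :=
    (hd _ (hUrot θ x hx)).hasFDerivAt.comp x (rotZL θ).hasFDerivAt
  have hr : HasFDerivAt (fun y => rotZL θ (u y)) ((rotZL θ).comp (fderiv ℝ u x)) x :=
    (rotZL θ).hasFDerivAt.comp x (hd x hx).hasFDerivAt
  have heq := (hr.congr_of_eventuallyEq hcomp).unique hl
  calc fderiv ℝ u (rotZ θ x)
      = ((fderiv ℝ u (rotZ θ x)).comp (rotZL θ)).comp (rotZL (-θ)) := by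
          rw [ContinuousLinearMap.comp_assoc, rotZL_comp_neg, ContinuousLinearMap.comp_id]
    _ = ((rotZL θ).comp (fderiv ℝ u x)).comp (rotZL (-θ)) := by rw [heq]
    _ = (rotZL θ).comp ((fderiv ℝ u x).comp (rotZL (-θ))) := by
          rw [ContinuousLinearMap.comp_assoc]

/-- **Equivariance of the curl, local form**: `curl u (R_θ x) = R_θ (curl u x)` for `x` in a
rotation-invariant open set on which `u` is differentiable and axially symmetric. [folklore] -/
theorem curl_rotZ_of_mem (hU : IsOpen U) (hUrot : ∀ θ : ℝ, ∀ x ∈ U, rotZ θ x ∈ U)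
    (hu : ∀ θ : ℝ, ∀ x ∈ U, u (rotZ θ x) = rotZ θ (u x))
    (hd : ∀ x ∈ U, DifferentiableAt ℝ u x) (θ : ℝ) {x : ℝ³} (hx : x ∈ U) :
    curl u (rotZ θ x) = rotZ θ (curl u x) := by
  rw [curl_eq_curlCLM, curl_eq_curlCLM, fderiv_rotZ_of_mem hU hUrot hu hd θ hx,
    curlCLM_rotZL_conj]

/-- The angular unit vector is equivariant under rotations about the axis:
`e_φ (R_θ x) = R_θ (e_φ x)`. [folklore] -/
theorem eTheta_rotZ (θ : ℝ) (x : ℝ³) : eTheta (rotZ θ x) = rotZ θ (eTheta x) := by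
  rw [eTheta, eTheta, cylRadius_rotZ]
  ext i
  fin_cases i <;> simp [rotZ] <;> ring

/-- Rotations about the axis preserve inner products. [folklore] -/
theorem inner_rotZ_rotZ (θ : ℝ) (v w : ℝ³) : ⟪rotZ θ v, rotZ θ w⟫ = ⟪v, w⟫ := by
  rw [← rotZLIE_apply, ← rotZLIE_apply, LinearIsometryEquiv.inner_map_map]

/-- **The angular vorticity is an axisymmetric scalar, local form**: `ω_φ (R_θ x) = ω_φ (x)` for
`x` in a rotation-invariant open set on which `u` is differentiable and axially symmetric.
[folklore] -/
theorem angularVorticity_rotZ_of_mem (hU : IsOpen U) (hUrot : ∀ θ : ℝ, ∀ x ∈ U, rotZ θ x ∈ U)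
    (hu : ∀ θ : ℝ, ∀ x ∈ U, u (rotZ θ x) = rotZ θ (u x))
    (hd : ∀ x ∈ U, DifferentiableAt ℝ u x) (θ : ℝ) {x : ℝ³} (hx : x ∈ U) :
    angularVorticity u (rotZ θ x) = angularVorticity u x := by
  rw [angularVorticity_apply, angularVorticity_apply, curl_rotZ_of_mem hU hUrot hu hd θ hx,
    eTheta_rotZ, inner_rotZ_rotZ]

end LocalSymmetry

/-! ### The cylindrical frame at meridian points -/

section Meridian

/-- At a meridian point the generator is `J (ϱ, 0, z) = ϱ e₁`. [folklore] -/
theorem rotGen_meridianPoint (q : ℝ × ℝ) :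
    rotGen (meridianPoint q) = q.1 • EuclideanSpace.single (1 : Fin 3) (1 : ℝ) := by
  ext i
  fin_cases i <;> simp [rotGen, meridianPoint]

/-- At a meridian point off the axis the angular unit vector is `e_φ (ϱ, 0, z) = e₁`, `ϱ > 0`.
[folklore] -/
theorem eTheta_meridianPoint {q : ℝ × ℝ} (hq : 0 < q.1) :
    eTheta (meridianPoint q) = EuclideanSpace.single (1 : Fin 3) (1 : ℝ) := by
  obtain ⟨ρ, z⟩ := q
  rw [eTheta, cylRadius_meridianPoint_eq_abs, abs_of_pos hq]
  ext i
  fin_cases i <;> simp [meridianPoint, (show (0 : ℝ) < ρ from hq).ne']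

/-- At a meridian point off the axis the radial unit vector is `e_ϱ (ϱ, 0, z) = e₀`, `ϱ > 0`
(the tree's `eR_meridianPoint`, in the pair form). [folklore] -/
theorem eR_meridianPoint' {q : ℝ × ℝ} (hq : 0 < q.1) :
    eR (meridianPoint q) = EuclideanSpace.single (0 : Fin 3) (1 : ℝ) := by
  obtain ⟨ρ, z⟩ := q
  exact eR_meridianPoint hq z

variable {u : ℝ³ → ℝ³} {q : ℝ × ℝ}

/-- **`∂₁u₁ = u₀/ϱ` at a meridian point**: if `Du(x)[J x] = J (u x)` at `x = (ϱ, 0, z)`,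
`ϱ > 0`, then `(Du(x) e₁)₁ = u₀(x)/ϱ` (`J x = ϱ e₁`, `(J v)₁ = v₀`). [folklore] -/
theorem fderiv_single_one_apply_one (hq : 0 < q.1)
    (hJ : fderiv ℝ u (meridianPoint q) (rotGen (meridianPoint q)) = rotGen (u (meridianPoint q))) :
    fderiv ℝ u (meridianPoint q) (EuclideanSpace.single 1 1) 1 = u (meridianPoint q) 0 / q.1 := by
  rw [rotGen_meridianPoint, map_smul] at hJ
  have h1 := congrArg (fun v : ℝ³ => v 1) hJ
  simp only [PiLp.smul_apply, smul_eq_mul, rotGen_apply_one] at h1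
  field_simp
  linarith [h1]

/-- **(4.3) at a meridian point**: `div u (x) = (Du e₀)₀ + u₀/ϱ + (Du e₂)₂` at `x = (ϱ, 0, z)`,
`ϱ > 0`, for a field with `Du(x)[J x] = J (u x)` (in cylindrical components
`div u = V_{ϱ,ϱ} + V_ϱ/ϱ + V_{3,3}`, so that `div u = 0` is Seregin–Zajaczkowski's (4.3)
`V_{ϱ,ϱ} + V_{3,3} = -V_ϱ/ϱ`). [cite: SereginZajaczkowski2007, proof of Lemma 4.2, (4.3)] -/
theorem divergence_meridianPoint (hq : 0 < q.1)
    (hJ : fderiv ℝ u (meridianPoint q) (rotGen (meridianPoint q)) = rotGen (u (meridianPoint q))) :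
    VectorCalculus.divergence u (meridianPoint q) =
      fderiv ℝ u (meridianPoint q) (EuclideanSpace.single 0 1) 0 + u (meridianPoint q) 0 / q.1 +
        fderiv ℝ u (meridianPoint q) (EuclideanSpace.single 2 1) 2 := by
  rw [divergence_eq_sum_inner_fderiv (EuclideanSpace.basisFun (Fin 3) ℝ), Fin.sum_univ_three]
  simp only [EuclideanSpace.basisFun_apply, EuclideanSpace.inner_single_left, map_one, one_mul]
  rw [fderiv_single_one_apply_one hq hJ]

/-- **(4.4) at a meridian point**: `ω_φ (x) = (Du e₂)₀ - (Du e₀)₂` at `x = (ϱ, 0, z)`, `ϱ > 0`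
(`e_φ = e₁` there, and the `e₁`-component of the curl is `∂₂u₀ - ∂₀u₂`; in cylindrical
components `ω_φ = V_{ϱ,3} - V_{3,ϱ}`, Seregin–Zajaczkowski's (4.4)).
[cite: SereginZajaczkowski2007, proof of Lemma 4.2, (4.4)] -/
theorem angularVorticity_meridianPoint (u : ℝ³ → ℝ³) (hq : 0 < q.1) :
    angularVorticity u (meridianPoint q) =
      fderiv ℝ u (meridianPoint q) (EuclideanSpace.single 2 1) 0 -
        fderiv ℝ u (meridianPoint q) (EuclideanSpace.single 0 1) 2 := by
  rw [angularVorticity_apply, eTheta_meridianPoint hq, EuclideanSpace.inner_single_right]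
  simp [curl]

end Meridian

/-! ### Cylindrical components on a shell are Cartesian components on the meridian half-plane -/

section Components

variable {R₁ R₂ A : ℝ} {u : ℝ³ → ℝ³}

/-- The meridian representative `m(x) = (ϱ(x), 0, x₃)` of a point of a shell lies in the shell.
[folklore] -/
theorem meridianPoint_meridian_mem_shell {x : ℝ³} (hx : x ∈ shell R₁ R₂ A) :
    meridianPoint (meridian x) ∈ shell R₁ R₂ A := by
  rw [mem_shell] at hx ⊢
  rw [meridian_apply, cylRadius_meridianPoint_eq_abs, abs_of_nonneg (cylRadius_nonneg x),
    meridianPoint_apply_two]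
  exact hx

/-- A point of `ℝ³` is the rotation of its meridian representative by the polar angle. [folklore] -/
theorem exists_rotZ_meridianPoint_eq (x : ℝ³) : ∃ θ : ℝ, rotZ θ (meridianPoint (meridian x)) = x :=
  ⟨_, rotZ_arg_meridianPoint x⟩

/-- **`|u(x)| = |u(m)|`** for the meridian representative `m` of a point `x` of a shell on which
`u` is axially symmetric. [folklore] -/
theorem norm_eq_meridianPoint (hu : ∀ θ : ℝ, ∀ x ∈ shell R₁ R₂ A, u (rotZ θ x) = rotZ θ (u x))
    {x : ℝ³} (hx : x ∈ shell R₁ R₂ A) :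
    ‖u x‖ = ‖u (meridianPoint (meridian x))‖ := by
  obtain ⟨θ, hθ⟩ := exists_rotZ_meridianPoint_eq x
  conv_lhs => rw [← hθ]
  rw [hu θ _ (meridianPoint_meridian_mem_shell hx), norm_rotZ]

/-- **`u_ϱ(x) = u₀(m)`**: the radial component at a point `x` of a shell (`R₁ ≥ 0`) on which `u`
is axially symmetric is the first Cartesian component at the meridian representative
(`e_ϱ(R_θ m) = R_θ e₀`). [folklore] -/
theorem radialVelocity_eq_meridianPoint (hR : 0 ≤ R₁)
    (hu : ∀ θ : ℝ, ∀ x ∈ shell R₁ R₂ A, u (rotZ θ x) = rotZ θ (u x))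
    {x : ℝ³} (hx : x ∈ shell R₁ R₂ A) :
    radialVelocity u x = u (meridianPoint (meridian x)) 0 := by
  obtain ⟨θ, hθ⟩ := exists_rotZ_meridianPoint_eq x
  have hm := meridianPoint_meridian_mem_shell hx
  have hρ : 0 < (meridian x).1 := hR.trans_lt hx.1.1
  -- `e_ϱ (R_θ m) = R_θ (e_ϱ m)` (the tree's `eR_rotZ` of `KatoLaiPeriodicCylinder`, inlined to keep
  -- the imports light)
  have heR : eR (rotZ θ (meridianPoint (meridian x))) = rotZ θ (eR (meridianPoint (meridian x))) := by
    rw [eR, eR, cylRadius_rotZ]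
    ext i
    fin_cases i <;> simp [rotZ] <;> ring
  conv_lhs => rw [← hθ]
  rw [radialVelocity, hu θ _ hm, heR, inner_rotZ_rotZ, eR_meridianPoint' hρ,
    EuclideanSpace.inner_single_right]
  simp

/-- **`u₃(x) = u₂(m)`**: the axial component is invariant under rotations about the axis.
[folklore] -/
theorem axialVelocity_eq_meridianPoint
    (hu : ∀ θ : ℝ, ∀ x ∈ shell R₁ R₂ A, u (rotZ θ x) = rotZ θ (u x))
    {x : ℝ³} (hx : x ∈ shell R₁ R₂ A) :
    axialVelocity u x = u (meridianPoint (meridian x)) 2 := by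
  obtain ⟨θ, hθ⟩ := exists_rotZ_meridianPoint_eq x
  conv_lhs => rw [← hθ]
  rw [axialVelocity_eq, hu θ _ (meridianPoint_meridian_mem_shell hx), rotZ_apply_two]

/-- **`|u^a(x)|² = u₀(m)² + u₂(m)²`**: the squared poloidal speed at a point of a shell
(`R₁ ≥ 0`) on which `u` is axially symmetric, read at the meridian representative.
[cite: SereginZajaczkowski2007, Lemma 4.2 (definition of |V^a|)] -/
theorem poloidalSpeed_sq_eq_meridianPoint (hR : 0 ≤ R₁)
    (hu : ∀ θ : ℝ, ∀ x ∈ shell R₁ R₂ A, u (rotZ θ x) = rotZ θ (u x))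
    {x : ℝ³} (hx : x ∈ shell R₁ R₂ A) :
    poloidalSpeed u x ^ 2 =
      u (meridianPoint (meridian x)) 0 ^ 2 + u (meridianPoint (meridian x)) 2 ^ 2 := by
  rw [poloidalSpeed_sq, radialVelocity_eq_meridianPoint hR hu hx,
    axialVelocity_eq_meridianPoint hu hx]

/-- **`ω_φ(x) = ω_φ(m)`** for the meridian representative of a point of a shell on which `u` is
differentiable and axially symmetric. [folklore] -/
theorem angularVorticity_eq_meridianPoint
    (hu : ∀ θ : ℝ, ∀ x ∈ shell R₁ R₂ A, u (rotZ θ x) = rotZ θ (u x))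
    (hd : ∀ x ∈ shell R₁ R₂ A, DifferentiableAt ℝ u x) {x : ℝ³} (hx : x ∈ shell R₁ R₂ A) :
    angularVorticity u x = angularVorticity u (meridianPoint (meridian x)) := by
  obtain ⟨θ, hθ⟩ := exists_rotZ_meridianPoint_eq x
  conv_lhs => rw [← hθ]
  exact angularVorticity_rotZ_of_mem (isOpen_shell R₁ R₂ A) (fun θ y hy => (rotZ_mem_shell_iff θ).2 hy)
    hu hd θ (meridianPoint_meridian_mem_shell hx)

end Components

/-! ### Calculus of meridian profiles and planar cut-offs -/

section Profiles

/-- The derivative of the meridian embedding applied to a planar vector: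
`D(meridianPoint)(q)(h₁, h₂) = h₁ e₀ + h₂ e₂`. [folklore] -/
theorem fderiv_meridianPoint_apply (q v : ℝ × ℝ) :
    fderiv ℝ meridianPoint q v =
      v.1 • EuclideanSpace.single (0 : Fin 3) (1 : ℝ) + v.2 • EuclideanSpace.single (2 : Fin 3) 1 := by
  rw [(hasFDerivAt_meridianPoint q).fderiv]
  simp

/-- A Cartesian component of `u ∘ meridianPoint` is `Cⁿ` at `q` when `u` is `Cⁿ` at
`meridianPoint q`. [folklore] -/
theorem contDiffAt_apply_comp_meridianPoint {u : ℝ³ → ℝ³} {q : ℝ × ℝ} {n : WithTop ℕ∞}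
    (hu : ContDiffAt ℝ n u (meridianPoint q)) (i : Fin 3) :
    ContDiffAt ℝ n (fun p : ℝ × ℝ => u (meridianPoint p) i) q := by
  have h : ContDiffAt ℝ n ((EuclideanSpace.proj i) ∘ (u ∘ meridianPoint)) q :=
    (EuclideanSpace.proj i).contDiff.contDiffAt.comp q
      (hu.comp q contDiff_meridianPoint.contDiffAt)
  exact h

/-- **Chain rule for meridian profiles**: `D(u ∘ meridianPoint · i)(q)(v) = (Du(x)(v₁ e₀ + v₂ e₂))ᵢ`,
`x = meridianPoint q`, for `u` differentiable at `x`. [folklore] -/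
theorem fderiv_apply_comp_meridianPoint {u : ℝ³ → ℝ³} {q : ℝ × ℝ}
    (hu : DifferentiableAt ℝ u (meridianPoint q)) (i : Fin 3) (v : ℝ × ℝ) :
    fderiv ℝ (fun p : ℝ × ℝ => u (meridianPoint p) i) q v =
      fderiv ℝ u (meridianPoint q)
        (v.1 • EuclideanSpace.single (0 : Fin 3) (1 : ℝ) + v.2 • EuclideanSpace.single (2 : Fin 3) 1) i := by
  have h := ((EuclideanSpace.proj i).hasFDerivAt.comp (meridianPoint q) hu.hasFDerivAt).comp q
    (hasFDerivAt_meridianPoint q)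
  rw [show (fun p : ℝ × ℝ => u (meridianPoint p) i) =
      ((EuclideanSpace.proj i) ∘ u) ∘ meridianPoint from rfl, h.fderiv]
  simp only [ContinuousLinearMap.coe_comp, comp_apply]
  rw [← (hasFDerivAt_meridianPoint q).fderiv, fderiv_meridianPoint_apply]
  rfl

variable {X : Type*} [NormedAddCommGroup X] [NormedSpace ℝ X]

/-- **A cut-off times a locally smooth function is smooth**: if `Ψ` is `Cⁿ` with
`tsupport Ψ ⊆ O` and `F` is `Cⁿ` at every point of `O`, then `Ψ · F` is `Cⁿ` (near a point
outside `tsupport Ψ` the product vanishes identically). [folklore] -/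
theorem contDiff_mul_of_tsupport_subset {Ψ F : X → ℝ} {O : Set X} {n : WithTop ℕ∞}
    (hΨ : ContDiff ℝ n Ψ) (hΨO : tsupport Ψ ⊆ O)
    (hF : ∀ p ∈ O, ContDiffAt ℝ n F p) : ContDiff ℝ n fun p => Ψ p * F p := by
  rw [contDiff_iff_contDiffAt]
  intro p
  by_cases hp : p ∈ tsupport Ψ
  · exact hΨ.contDiffAt.mul (hF p (hΨO hp))
  · have h0 : (fun y => Ψ y * F y) =ᶠ[𝓝 p] fun _ => 0 := by
      filter_upwards [notMem_tsupport_iff_eventuallyEq.1 hp] with y hy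
      rw [hy, Pi.zero_apply, zero_mul]
    exact (contDiffAt_const (c := (0 : ℝ))).congr_of_eventuallyEq h0

/-- **Product rule at a point of `O`** for the cut-off product: at `p ∈ O` (where `F` is
differentiable), `D(Ψ F)(p) v = DΨ(p) v · F p + Ψ p · DF(p) v`. [folklore] -/
theorem fderiv_mul_apply_of_differentiableAt {Ψ F : X → ℝ} {p : X}
    (hΨ : DifferentiableAt ℝ Ψ p) (hF : DifferentiableAt ℝ F p) (v : X) :
    fderiv ℝ (fun y => Ψ y * F y) p v = fderiv ℝ Ψ p v * F p + Ψ p * fderiv ℝ F p v := by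
  have h : (Ψ p • fderiv ℝ F p + F p • fderiv ℝ Ψ p) v =
      Ψ p * fderiv ℝ F p v + F p * fderiv ℝ Ψ p v := rfl
  rw [fderiv_fun_mul hΨ hF, h]
  ring

/-- **The cut-off product and its derivative vanish outside the support of the cut-off.**
[folklore] -/
theorem fderiv_mul_apply_of_notMem_tsupport {Ψ F : X → ℝ} {p : X} (hp : p ∉ tsupport Ψ)
    (v : X) : fderiv ℝ (fun y => Ψ y * F y) p v = 0 := by
  have h0 : (fun y => Ψ y * F y) =ᶠ[𝓝 p] fun _ => 0 := by
    filter_upwards [notMem_tsupport_iff_eventuallyEq.1 hp] with y hy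
    rw [hy, Pi.zero_apply, zero_mul]
  rw [h0.fderiv_eq, fderiv_const_apply, zero_apply]

end Profiles

/-! ### Two odds and ends of the passage `dx ↔ dϱ dx₃` -/

section Planar

/-- **A linear form on `ℝ × ℝ` is controlled by its two partial values**:
`‖L‖ ≤ |L(1, 0)| + |L(0, 1)|` (for the sup norm of `ℝ × ℝ`). [folklore] -/
theorem norm_le_abs_add_abs (L : ℝ × ℝ →L[ℝ] ℝ) : ‖L‖ ≤ |L (1, 0)| + |L (0, 1)| := by
  refine ContinuousLinearMap.opNorm_le_bound _ (by positivity) fun h => ?_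
  have hdecomp : h = h.1 • ((1 : ℝ), (0 : ℝ)) + h.2 • ((0 : ℝ), (1 : ℝ)) := by
    ext <;> simp
  conv_lhs => rw [hdecomp]
  rw [map_add, map_smul, map_smul, smul_eq_mul, smul_eq_mul, Real.norm_eq_abs]
  refine (abs_add_le _ _).trans ?_
  rw [abs_mul, abs_mul, add_mul]
  have h1 : |h.1| ≤ ‖h‖ := by rw [← Real.norm_eq_abs]; exact norm_fst_le h
  have h2 : |h.2| ≤ ‖h‖ := by rw [← Real.norm_eq_abs]; exact norm_snd_le h
  nlinarith [abs_nonneg (L (1, 0)), abs_nonneg (L (0, 1))]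

/-- Hence `‖L‖² ≤ 2 (L(1,0)² + L(0,1)²)`. [folklore] -/
theorem norm_sq_le_two_mul (L : ℝ × ℝ →L[ℝ] ℝ) : ‖L‖ ^ 2 ≤ 2 * (L (1, 0) ^ 2 + L (0, 1) ^ 2) := by
  have h := norm_le_abs_add_abs L
  have h0 : 0 ≤ ‖L‖ := norm_nonneg _
  nlinarith [sq_abs (L (1, 0)), sq_abs (L (0, 1)), abs_nonneg (L (1, 0)), abs_nonneg (L (0, 1)),
    sq_nonneg (|L (1, 0)| - |L (0, 1)|)]

/-- **Even reflection in the first variable**: for an integrable `Y : ℝ × ℝ → ℝ` vanishing on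
`{ϱ ≤ 0}`, `∫ Y(|ϱ|, z) d(ϱ, z) = 2 ∫ Y` (pointwise `Y(|ϱ|, z) = Y(ϱ, z) + Y(-ϱ, z)`, and the
reflection `ϱ ↦ -ϱ` preserves Lebesgue measure). [folklore] -/
theorem integral_comp_abs_fst {Y : ℝ × ℝ → ℝ} (hY : Integrable Y)
    (hY0 : ∀ q : ℝ × ℝ, q.1 ≤ 0 → Y q = 0) :
    ∫ q : ℝ × ℝ, Y (|q.1|, q.2) = 2 * ∫ q, Y q := by
  -- the reflection as a measure-preserving equivalence
  set e : ℝ × ℝ ≃ᵐ ℝ × ℝ := MeasurableEquiv.prodCongr (MeasurableEquiv.neg ℝ) (MeasurableEquiv.refl ℝ)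
    with he
  have hep : MeasurePreserving e volume volume := by
    rw [he, Measure.volume_eq_prod]
    exact (Measure.measurePreserving_neg (volume : Measure ℝ)).prod (MeasurePreserving.id _)
  have hrefl : ∫ q : ℝ × ℝ, Y (-q.1, q.2) = ∫ q, Y q :=
    hep.integral_comp e.measurableEmbedding Y
  have hpt : ∀ q : ℝ × ℝ, Y (|q.1|, q.2) = Y q + Y (-q.1, q.2) := by
    rintro ⟨ρ, z⟩
    rcases le_or_gt ρ 0 with hρ | hρ
    · rw [abs_of_nonpos hρ, hY0 (ρ, z) hρ, zero_add]
    · rw [abs_of_pos hρ, hY0 (-ρ, z) (by simp [hρ.le]), add_zero]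
  have hint : Integrable fun q : ℝ × ℝ => Y (-q.1, q.2) :=
    (hep.integrable_comp_emb e.measurableEmbedding).2 hY
  simp_rw [hpt]
  rw [integral_add hY hint, hrefl, two_mul]

end Planar

end SereginZajaczkowski2007

end Literature.Analysis.FluidPDE
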